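import Literature.MathematicalPhysics.QuantumFieldTheory.Balaban1983to89.B9Eq316AveragingTransposeZdLevelZero
import Literature.MathematicalPhysics.QuantumFieldTheory.Balaban1983to89.B9Eq342CombesThomasFormZd

/-!
# `Balaban1983to89.B9Eq326LocalLettersBumpBoundsZd` — [Balaban1985BackgroundPropagators] (3.26) p. 395 «Δ_a = Δ + DRD* + Q*aQ», (3.4)∕(3.9) p. 391–392
# (`D*D`), (3.10) p. 392 ∕ (3.69) p. 404 (`Δ′`), (3.16) p. 393 (`Q*aQ`): THE THREE LOCAL LETTERS OF `Δ_a(U₀)` ON A SINGLE-BOND BUMP ARE FINITE-RANGE AND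
# BOUNDED — `|(D*D δ_{b′}w)(b)|_τ ≤ B_J·𝟙[|b−b′|_∞ ≤ 1]·|w|_τ`, `|(Δ′(U₀)δ_{b′}w)(b)|_τ ≤ B_{Δ′}·𝟙[|b−b′|_∞ ≤ 1]·|w|_τ`,
# `|(Q*aQ(U₀)δ_{b′}w)(b)|_τ ≤ B_Q·𝟙[|b−b′|_∞ ≤ 2Lᵐ]·|w|_τ` at EVERY unitary background `U₀`, for the genuine letters `Jcur`, `DpZd`, `QQZdP` of the
# J-N06→N05 junction's four-letter record `opsAllZd` — the three displayed hypotheses `hJ ∕ hDp ∕ hQQ` of dag-n06-w2's station-5 assembly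
# `B9Eq326DeltaAMajorantAssemblyZd.fnorm_deltaAOf_bump_le_of_letters`, in their exact shape

statement-level skeleton of published theorems with citation tags; proofs where landed; nothing here is a claim about the
Yang–Mills mass gap

`[Balaban1985BackgroundPropagators]` ("B9", CMP **99** (1985) 389–434): (3.4) p. 391 (the plaquette covariant derivative), (3.9)–(3.10) p. 392
(`Δ = D*D + Δ′`), (3.16) p. 393 («we define an operator Q*aQ»), (3.26) p. 395 («Δ_a(U) = Δ(U) + D_UR(U)D*_U + Q*(U)aQ(U)»), (3.69) p. 404
(«Δ′ … is a small perturbation … the supremum on the right-hand side is taken over bonds belonging to one of the plaquettes containing the bond b»);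
[Balaban1985RegularSpaces] (1.1)–(1.2) p. 76, (1.55) p. 86 (`J = D*_{U₀}D_{U₀}A`), (1.7) p. 77; [Balaban1985Averaging] p. 24 (locality of the averages
«depends only on the bond variables U_b for b ⊂ B^k(c₋) ∪ B^k(c₊)»), (147) p. 40 (the column bound of the linearised averaging).  HERE: elementary
kinematics — which bonds a local letter reads and how large its coefficients are at a unitary background — in the fibre size `|a|_τ = √(Re τ(a*a))` of
dag-n06-w2's Combes–Thomas road (`B9Eq342CombesThomasFormZd.fnorm`), reached from the tree's OPERATOR-NORM locality ∕ size lemmas through a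
two-sided comparison `|a|_τ ≤ C_u‖a‖`, `‖a‖ ≤ C_l|a|_τ` (automatic on a finite-dimensional fibre with faithful `τ`, §0).

CITATION HEADER (lean-in-tree rule).  Cell `pub-ymgap` (YM Track A, HUMAN RULING D-0062 ∕ D-0149 width push), DAG node N06 = [B9], seat
`pub-ymgap-dag-n06-b` (g21; junction ∕ letter lineage), answering dag-n06-w2 g4's ASK (INBOX l.36611).  Inputs BY NAME: `B8Eq155JBound.Jcur` with this
lineage's `B9SupplySockB9P3Zd.norm_Jcur_le_of_grad`, `B9SupplySockB9P3ZdLettersOmega.{Jcur_congr_ball, Jcur_zero, norm_covDerivFwd_le}`; dag-n06-w2's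
`B9Eq369CurvSmallZd.{DpZd, DpZd_congr_local, DpZd_smul, norm_DpZd_le_local}`; this lineage's `B9Eq316AveragingTransposeZd.{linCovIterT, betaTau, wQ, clsField,
winBase, inBox_winBase, norm_linCovIterT_le, alphaQ, Reg17}`, `B9Eq316AveragingTransposeZdPrinted.{QQZdP, QQZdP_of_reg17, QQZdP_of_not_reg17, reg17_shift}`,
`B9Eq316AveragingTransposeZdLevelZero.{norm_linCovIter_bump_le_of_reg17₀, hbox0_cubeLamBP_of_eq}`; `B9Ineq3137LocalSup.linCovIter_congr`,
`B9SupplySockB9P3ZdAtBoundaryMode.linCovIter_zero_fun`; dag-n06-w4's record `B9SupplySockB9P3ZdAllLettersZd.opsAllZd` (`opsAllZd_Dp ∕ opsAllZd_QQ` by `rfl`);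
dag-n06-w2's `B9Eq342CombesThomasFormZd.{fnorm, fnorm_smul, fnorm_eq_zero_iff}`.  Nothing restated.

WHAT IS PROVED (kernel, 0 sorry, 0 def).
* §0 `fnorm_le_indicator_of_norm_le` (transfer of an operator-norm bump bound to the fibre size through `(C_u, C_l)`), `indicator_linfDist_mono` ∕
  `fnorm_le_indicator_mono` (a bound of range `r` is one of every range `r′ ≥ r`), ★ `exists_fnorm_cmp` (on a finite-dimensional fibre with faithful `τ`:
  `∃ C_u C_l > 0`, `|a|_τ ≤ C_u‖a‖`, `‖a‖ ≤ C_l|a|_τ` — compactness of the unit sphere).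
* §1 `D*D`: `Jcur_bump_eq_zero_of_not_near` (range `1` in `|·|_∞`), `norm_Jcur_bump_le` (`‖(D*Dδ_{(z,κ)}w)(x,μ)‖ ≤ 16d·η⁻²·‖w‖`, unitary `U₀`),
  `norm_Jcur_bump_le_indicator`, ★★ `fnorm_Jcur_bump_le` (w2's `hJ` with `B_J = C_u·16dη⁻²·C_l`, `r = 1`).
* §2 `Δ′`: `linfDist_le_one_of_bondNear`, `DpZd_zero`, `DpZd_bump_eq_zero_of_not_near` (range `1`), `norm_DpZd_bump_le` (`≤ 28(d−1)·η⁻²·‖w‖`, unitary `U₀` —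
  print's (3.69) with `|U₀(∂p) − 1| ≤ 2`), `norm_DpZd_bump_le_indicator`, ★★ `fnorm_DpZd_bump_le` (w2's `hDp`, `B_{Δ′} = C_u·28(d−1)η⁻²·C_l`, `r = 1`).
* §3 `Q*aQ` (EDITION P letter `QQZdP` at a member `(i, m)`, class `ΛbP` with the level-`≥ 1` box clause «box ⊂ Ω_{j−1}»): `linfDist_le_of_inBox_inBox` (two sites of
  one averaging box are `2Lʲ`-close), `norm_clsField_bump_le` (the level-`j` input at a window bond: column bound (147) × `𝟙[|y−y′|_∞ ≤ 2Lᵐ]`),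
  ★★ `norm_QQZdP_bump_le` (`‖(Q*aQ δ_{(y′,μ′)}w)(y,μ)‖ ≤ B_Q·𝟙[|y−y′|_∞ ≤ 2Lᵐ]·‖w‖` at EVERY unitary `U₀`, explicit
  `B_Q = C_τβ_τ·2d·η·Σ_{j≤m} w_j·((1+θ(α_Q))LʲL^{−jd})²`; off the regime (1.7) the letter is `0`), ★★ `fnorm_QQZdP_bump_le` (w2's `hQQ`, `r_Q = 2Lᵐ`).
* §4 the record: ★★★ `fnorm_Dp_opsAllZd_bump_le` ∕ ★★★ `fnorm_QQ_opsAllZd_bump_le` (the `Dp` ∕ `QQ` fields of `opsAllZd τ L ΛbP ops₀ M i m` on bumps, w2's `hDp ∕ hQQ`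
  VERBATIM at `o := opsAllZd …`), ★★★ `fnorm_QQ_opsAllZd_bump_le_cube` (print's class `cubeLamBP` of the cube member: the box clause discharged by
  `hbox0_cubeLamBP_of_eq`), and ★★★ `exists_letterBounds_opsAllZd_cube` (the three bounds packaged AT ONE RANGE `r = 2Lᵐ`: `∃ B_J B_{Δ′} B_Q ≥ 0` for every unitary
  `U₀`, all `b b′ w` — dag-n06-w2's single-range `B_loc·𝟙[|b−b′|_∞ ≤ r]` shape).

HONEST SCOPE.  Count-neutral helper: bookkeeping of ranges and crude coefficient sizes (constants `η⁻²`, `(d, L, m)`, the fibre constants `C_τ, β_τ, C_u, C_l`);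
member-dependent through `η = i.η` and `m`; NOT print's uniform constants; the non-local letter `DRD*` is dag-n06-w2's `B9Eq326DRDsKernelDecayZd` and is not
touched; nothing of [Balaban1985BackgroundPropagators] Thm 3.1 ∕ 3.3 ∕ 3.11 is asserted; N05 ∕ N06 NOT discharged; K1⁹ `stmt-QuantumFields-27364` NOT closed;
one finite `𝕋⁴` programme at fixed `ε`, Bałaban as printed; R4 closes only the conditional finite-`𝕋⁴` rung `BalabanLadder.UV` — nothing continuum ∕ ℝ⁴ ∕ OS ∕
mass gap ∕ Clay.  Unit `pub-ymgap-dag-n06-b` (g21), 2026-08-28.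
-/

noncomputable section

open scoped BigOperators

namespace Literature.MathematicalPhysics.QuantumFieldTheory.Balaban1983to89.B9Eq326LocalLettersBumpBoundsZd

open B7Prop1Explicit (U1 e hol plaqWord)
open B7Prop1Local (InBox loK bondHiK AgreeOn)
open B7Prop2Explicit (unitaryUnits unitaryUnits_le_U1)
open B7Prop5Flat (bump bump_eq_zero_of BondIn)
open B7Prop4GeneralLevels (linCovIter)
open B7Prop5GeneralLevels (thetaGen)
open B8Ineq132 (plaqF covDerivFwd)
open B8Eq140Level (IsSide PlaqNear BondNear)
open B8Eq146AExpansion (iEta)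
open B8Eq155JBound (Jcur)
open B8Eq131CubesAdmissible (cubeFam)
open B8Ineq159FlatCubeMemberPrinted (cubeLamBP)
open B8LeafModelZd (ZdIdx)
open B9Eq369CurvSmallZd (DpZd DpZd_congr_local DpZd_smul norm_DpZd_le_local)
open B9SupplySockB9P3Zd (norm_Jcur_le_of_grad)
open B9SupplySockB9P3ZdLettersOmega (Jcur_congr_ball Jcur_zero norm_covDerivFwd_le)
open B9SupplySockB9P3ZdAtBoundaryMode (linCovIter_zero_fun)
open B9Ineq3137LocalSup (linCovIter_congr)
open B9Eq316AveragingTransposeZd (betaTau linCovIterT alphaQ alphaQ_pos Reg17 wQ clsField winBase inBox_winBase norm_linCovIterT_le)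
open B9Eq316AveragingTransposeZdPrinted (QQZdP QQZdP_of_reg17 QQZdP_of_not_reg17 reg17_shift)
open B9Eq316AveragingTransposeZdLevelZero (norm_linCovIter_bump_le_of_reg17₀ hbox0_cubeLamBP_of_eq)
open B9SupplySockB9P3ZdLetters (OpsZd)
open B9SupplySockB9P3ZdAllLettersZd (opsAllZd opsAllZd_Dp opsAllZd_QQ)
open B9Eq342CombesThomasFormZd (fnorm fnorm_nonneg fnorm_smul fnorm_eq_zero_iff)
open LatticeNorms (linfDist linfDist_le_iff linfDist_comm)

-- `Site` alone could resolve to the torus sites of `Setup.lean`; re-export the `ℤ^d` sites of `B7Prop1Explicit`.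
export B7Prop1Explicit (Site)

variable {d : ℕ} {𝔸 : Type*} [CStarAlgebra 𝔸]

/-! ## §0  The fibre size against the operator norm -/

section Fibre

variable (τ : 𝔸 →ₗ[ℂ] ℂ)

/-- **TRANSFER OF AN OPERATOR-NORM BUMP BOUND TO THE FIBRE SIZE** through a two-sided comparison `|a|_τ ≤ C_u‖a‖`, `‖a‖ ≤ C_l|a|_τ`:
`‖F‖ ≤ K·𝟙_P·‖w‖ ⟹ |F|_τ ≤ (C_u·K·C_l)·𝟙_P·|w|_τ`. [cite: Balaban1985BackgroundPropagators, p.390 («|X|² = tr X*X»; bookkeeping)] -/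
theorem fnorm_le_indicator_of_norm_le {Cu Cl : ℝ} (hCu : ∀ a : 𝔸, fnorm τ a ≤ Cu * ‖a‖) (hCl : ∀ a : 𝔸, ‖a‖ ≤ Cl * fnorm τ a) (hCu0 : 0 ≤ Cu)
    {K : ℝ} (hK : 0 ≤ K) {F w : 𝔸} {P : Prop} [Decidable P] (hF : ‖F‖ ≤ K * (if P then (1 : ℝ) else 0) * ‖w‖) :
    fnorm τ F ≤ (Cu * K * Cl) * (if P then (1 : ℝ) else 0) * fnorm τ w := by
  have hind : 0 ≤ K * (if P then (1 : ℝ) else 0) := mul_nonneg hK (by split_ifs <;> norm_num)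
  calc fnorm τ F ≤ Cu * ‖F‖ := hCu F
    _ ≤ Cu * (K * (if P then (1 : ℝ) else 0) * ‖w‖) := mul_le_mul_of_nonneg_left hF hCu0
    _ ≤ Cu * (K * (if P then (1 : ℝ) else 0) * (Cl * fnorm τ w)) :=
        mul_le_mul_of_nonneg_left (mul_le_mul_of_nonneg_left (hCl w) hind) hCu0
    _ = (Cu * K * Cl) * (if P then (1 : ℝ) else 0) * fnorm τ w := by ring

omit [CStarAlgebra 𝔸] in
/-- the range indicator grows with the range: `𝟙[|x−z|_∞ ≤ r] ≤ 𝟙[|x−z|_∞ ≤ r′]` for `r ≤ r′`. [cite: Balaban1985BackgroundPropagators, (3.42) p.397 (bookkeeping)] -/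
theorem indicator_linfDist_mono (x z : Site d) {r r' : ℕ} (h : r ≤ r') :
    (if linfDist x z ≤ r then (1 : ℝ) else 0) ≤ (if linfDist x z ≤ r' then (1 : ℝ) else 0) := by
  split_ifs with h1 h2
  · exact le_rfl
  · exact absurd (h1.trans h) h2
  · exact zero_le_one
  · exact le_rfl

/-- **A BUMP BOUND OF RANGE `r` IS A BUMP BOUND OF EVERY LARGER RANGE** (`B ≥ 0`): `|F|_τ ≤ B·𝟙[≤ r]·|w|_τ ⟹ |F|_τ ≤ B·𝟙[≤ r′]·|w|_τ` for `r ≤ r′` — the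
three letters are offered below at their own ranges (`1`, `1`, `2Lᵐ`) and, for dag-n06-w2's single-range majorant `B_loc·𝟙[≤ r]`, at a common one.
[cite: Balaban1985BackgroundPropagators, (3.42) p.397 (bookkeeping)] -/
theorem fnorm_le_indicator_mono {B : ℝ} (hB : 0 ≤ B) {F w : 𝔸} (x z : Site d) {r r' : ℕ} (h : r ≤ r')
    (hF : fnorm τ F ≤ B * (if linfDist x z ≤ r then (1 : ℝ) else 0) * fnorm τ w) :
    fnorm τ F ≤ B * (if linfDist x z ≤ r' then (1 : ℝ) else 0) * fnorm τ w :=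
  hF.trans (mul_le_mul_of_nonneg_right (mul_le_mul_of_nonneg_left (indicator_linfDist_mono x z h) hB) (fnorm_nonneg τ w))

/-- ★ **THE FIBRE SIZE AND THE OPERATOR NORM ARE COMPARABLE** on a finite-dimensional fibre with a faithful positive `τ`: `∃ C_u, C_l > 0` with `|a|_τ ≤ C_u‖a‖`
and `‖a‖ ≤ C_l|a|_τ` for all `a` (the continuous function `a ↦ |a|_τ` is positive on the compact unit sphere; real homogeneity `|t·a|_τ = |t|·|a|_τ`).
[cite: Balaban1985BackgroundPropagators, p.390 («|X|² = tr X*X»), p.391 («X·Y = tr XY»)] -/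
theorem exists_fnorm_cmp [FiniteDimensional ℝ 𝔸] [Nontrivial 𝔸] (hτp : ∀ a : 𝔸, a ≠ 0 → 0 < (τ (star a * a)).re) :
    ∃ Cu Cl : ℝ, 0 < Cu ∧ 0 < Cl ∧ (∀ a : 𝔸, fnorm τ a ≤ Cu * ‖a‖) ∧ (∀ a : 𝔸, ‖a‖ ≤ Cl * fnorm τ a) := by
  have hcont : Continuous fun a : 𝔸 => fnorm τ a := by
    have hτc : Continuous fun a : 𝔸 => τ a := (τ.restrictScalars ℝ).continuous_of_finiteDimensional
    exact Real.continuous_sqrt.comp (Complex.continuous_re.comp (hτc.comp (continuous_star.mul continuous_id)))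
  have hK : IsCompact (Metric.sphere (0 : 𝔸) 1) := isCompact_sphere 0 1
  obtain ⟨x₀, hx₀⟩ : ∃ x : 𝔸, x ≠ 0 := exists_ne 0
  have hsph : ∀ a : 𝔸, a ≠ 0 → ‖a‖⁻¹ • a ∈ Metric.sphere (0 : 𝔸) 1 := fun a ha => by
    rw [mem_sphere_zero_iff_norm, norm_smul, norm_inv, norm_norm, inv_mul_cancel₀ (norm_ne_zero_iff.mpr ha)]
  have hne : (Metric.sphere (0 : 𝔸) 1).Nonempty := ⟨_, hsph x₀ hx₀⟩
  obtain ⟨u, hu, hmin⟩ := hK.exists_isMinOn hne hcont.continuousOn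
  obtain ⟨v, hv, hmax⟩ := hK.exists_isMaxOn hne hcont.continuousOn
  have hu0 : u ≠ 0 := by
    intro h
    rw [h, mem_sphere_zero_iff_norm, norm_zero] at hu
    exact zero_ne_one hu
  have hκ : 0 < fnorm τ u := lt_of_le_of_ne (fnorm_nonneg τ u) (fun h => hu0 ((fnorm_eq_zero_iff hτp u).1 h.symm))
  -- the homogeneity `|a|_τ = ‖a‖·|‖a‖⁻¹•a|_τ`
  have hscale : ∀ a : 𝔸, a ≠ 0 → fnorm τ a = ‖a‖ * fnorm τ (‖a‖⁻¹ • a) := by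
    intro a ha
    have hna : 0 < ‖a‖ := norm_pos_iff.mpr ha
    rw [fnorm_smul, abs_of_pos (inv_pos.mpr hna), ← mul_assoc, mul_inv_cancel₀ hna.ne', one_mul]
  refine ⟨max (fnorm τ v) 1, (fnorm τ u)⁻¹, lt_of_lt_of_le zero_lt_one (le_max_right _ _), inv_pos.mpr hκ, fun a => ?_, fun a => ?_⟩
  · by_cases ha : a = 0
    · simp [ha, B9Eq342CombesThomasFormZd.fnorm_zero]
    · rw [hscale a ha, mul_comm]
      exact mul_le_mul_of_nonneg_right ((hmax (hsph a ha)).trans (le_max_left _ _)) (norm_nonneg a)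
  · by_cases ha : a = 0
    · rw [ha, norm_zero]
      exact mul_nonneg (inv_pos.mpr hκ).le (fnorm_nonneg τ _)
    · have hna : 0 < ‖a‖ := norm_pos_iff.mpr ha
      have hle : fnorm τ u ≤ fnorm τ (‖a‖⁻¹ • a) := hmin (hsph a ha)
      rw [hscale a ha, le_inv_mul_iff₀' hκ]
      exact mul_le_mul_of_nonneg_left hle hna.le

end Fibre

/-! ## §1  The letter `D*D` (`Jcur`) on a bump: range `1`, size `16d·η⁻²` -/

section Current

omit [CStarAlgebra 𝔸] in
/-- the `ℓ^∞` unit ball of a site in coordinates. [folklore] -/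
private theorem linfDist_le_one_iff (x y : Site d) : linfDist x y ≤ 1 ↔ ∀ i, x i - 1 ≤ y i ∧ y i ≤ x i + 1 := by
  rw [linfDist_le_iff]
  refine forall_congr' fun i => ?_
  omega

/-- the single-bond variation is bounded by its value everywhere. [folklore] -/
private theorem norm_bump_apply_le (z : Site d) (κ : Fin d) (w : 𝔸) (x : Site d) (ν : Fin d) : ‖bump z κ w x ν‖ ≤ ‖w‖ := by
  unfold bump
  split_ifs
  · exact le_rfl
  · rw [norm_zero]; exact norm_nonneg _

/-- **RANGE `1`**: `(D*D δ_{(z,κ)}w)(x, μ) = 0` unless `|x − z|_∞ ≤ 1` (the current reads the field on the sides of the plaquettes through the bond only).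
[cite: Balaban1985RegularSpaces, (1.55) p.86, (1.1)–(1.2) p.76; Balaban1985BackgroundPropagators, (3.4) p.391, (3.9) p.392] -/
theorem Jcur_bump_eq_zero_of_not_near (η : ℝ) (U₀ : Site d → Fin d → 𝔸ˣ) (z : Site d) (κ : Fin d) (w : 𝔸) (μ : Fin d) (x : Site d)
    (h : ¬ linfDist x z ≤ 1) : Jcur η U₀ (bump z κ w) μ x = 0 := by
  rw [← Jcur_zero η U₀ μ x]
  refine Jcur_congr_ball μ fun y ν hy => ?_
  have hyz : y ≠ z := fun hyz => h ((linfDist_le_one_iff x z).2 (hyz ▸ hy))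
  exact bump_eq_zero_of w fun hh => hyz hh.1

variable [Nontrivial 𝔸]

/-- **SIZE `16d·η⁻²`** at a unitary background: `‖(D*D δ_{(z,κ)}w)(x, μ)‖ ≤ 16d·η⁻²·‖w‖` (each plaquette derivative of the bump costs `2η⁻¹‖w‖`, the divergence
`8d·η⁻¹` of that — `norm_Jcur_le_of_grad`). [cite: Balaban1985RegularSpaces, (1.55) p.86, (1.1)–(1.2) p.76; Balaban1985BackgroundPropagators, (3.4) p.391, (3.28) p.395] -/
theorem norm_Jcur_bump_le {η : ℝ} (hη : 0 < η) {U₀ : Site d → Fin d → 𝔸ˣ} (hU : ∀ (x : Site d) (κ : Fin d), U₀ x κ ∈ unitaryUnits 𝔸)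
    (z : Site d) (κ : Fin d) (w : 𝔸) (μ : Fin d) (x : Site d) :
    ‖Jcur η U₀ (bump z κ w) μ x‖ ≤ 16 * d * (η⁻¹) ^ 2 * ‖w‖ := by
  have hU1 : ∀ (y : Site d) (ν : Fin d), U₀ y ν ∈ U1 𝔸 := fun y ν => unitaryUnits_le_U1 (hU y ν)
  have hG : ∀ (y : Site d) (κ' ν : Fin d), ‖covDerivFwd η U₀ κ' (fun s => bump z κ w s ν) y‖ ≤ η⁻¹ * (2 * ‖w‖) := by
    intro y κ' ν
    refine (norm_covDerivFwd_le hη (hU1 y κ') _).trans (mul_le_mul_of_nonneg_left ?_ (inv_nonneg.mpr hη.le))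
    linarith [norm_bump_apply_le z κ w (y + e κ') ν, norm_bump_apply_le z κ w y ν]
  refine (norm_Jcur_le_of_grad hη hU1 hG μ x).trans (le_of_eq ?_)
  ring

/-- size and range together: `‖(D*D δ_{(z,κ)}w)(x, μ)‖ ≤ 16dη⁻²·𝟙[|x − z|_∞ ≤ 1]·‖w‖`. [cite: Balaban1985RegularSpaces, (1.55) p.86; Balaban1985BackgroundPropagators, (3.9) p.392] -/
theorem norm_Jcur_bump_le_indicator {η : ℝ} (hη : 0 < η) {U₀ : Site d → Fin d → 𝔸ˣ} (hU : ∀ (x : Site d) (κ : Fin d), U₀ x κ ∈ unitaryUnits 𝔸)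
    (z : Site d) (κ : Fin d) (w : 𝔸) (μ : Fin d) (x : Site d) :
    ‖Jcur η U₀ (bump z κ w) μ x‖ ≤ 16 * d * (η⁻¹) ^ 2 * (if linfDist x z ≤ 1 then (1 : ℝ) else 0) * ‖w‖ := by
  split_ifs with h
  · rw [mul_one]; exact norm_Jcur_bump_le hη hU z κ w μ x
  · rw [Jcur_bump_eq_zero_of_not_near η U₀ z κ w μ x h, norm_zero, mul_zero, zero_mul]

/-- ★★ **THE `hJ` HYPOTHESIS OF THE STATION-5 ASSEMBLY**: at a unitary background, for all bonds `b, b′` and `w`,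
`|(D*D δ_{b′}w)(b)|_τ ≤ (C_u·16dη⁻²·C_l)·𝟙[|b−b′|_∞ ≤ 1]·|w|_τ`. [cite: Balaban1985BackgroundPropagators, (3.26) p.395, (3.9) p.392; Balaban1985RegularSpaces, (1.55) p.86] -/
theorem fnorm_Jcur_bump_le (τ : 𝔸 →ₗ[ℂ] ℂ) {Cu Cl : ℝ} (hCu : ∀ a : 𝔸, fnorm τ a ≤ Cu * ‖a‖) (hCl : ∀ a : 𝔸, ‖a‖ ≤ Cl * fnorm τ a)
    (hCu0 : 0 ≤ Cu) {η : ℝ} (hη : 0 < η) {U₀ : Site d → Fin d → 𝔸ˣ} (hU : ∀ (x : Site d) (κ : Fin d), U₀ x κ ∈ unitaryUnits 𝔸)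
    (b b' : Site d × Fin d) (w : 𝔸) :
    fnorm τ (Jcur η U₀ (bump b'.1 b'.2 w) b.2 b.1) ≤
      (Cu * (16 * d * (η⁻¹) ^ 2) * Cl) * (if linfDist b.1 b'.1 ≤ 1 then (1 : ℝ) else 0) * fnorm τ w :=
  fnorm_le_indicator_of_norm_le τ hCu hCl hCu0 (by positivity) (norm_Jcur_bump_le_indicator hη hU b'.1 b'.2 w b.2 b.1)

end Current

/-! ## §2  The letter `Δ′(U₀)` (`DpZd`) on a bump: range `1`, size `28(d−1)·η⁻²` -/

section Curvature

omit [CStarAlgebra 𝔸] in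
/-- a side of a plaquette is `1`-close to its corner, in coordinates. [folklore] -/
private theorem near_of_isSide {z y : Site d} {κ ν τ : Fin d} (h : IsSide z κ ν y τ) : ∀ i, z i ≤ y i ∧ y i ≤ z i + 1 := by
  intro i
  rcases h with ⟨rfl, -⟩ | ⟨rfl, -⟩ | ⟨rfl, -⟩ | ⟨rfl, -⟩
  · exact ⟨le_rfl, by omega⟩
  · simp only [Pi.add_apply, B7Prop1Explicit.e_apply]; split_ifs <;> omega
  · simp only [Pi.add_apply, B7Prop1Explicit.e_apply]; split_ifs <;> omega
  · exact ⟨le_rfl, by omega⟩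

omit [CStarAlgebra 𝔸] in
/-- **the sides of the plaquettes through a bond are `1`-close to it**: `BondNear μ x y τ → |x − y|_∞ ≤ 1`. [cite: Balaban1985BackgroundPropagators, p.404 (after (3.69), «st(b)»); Balaban1985RegularSpaces, (1.45) p.84] -/
theorem linfDist_le_one_of_bondNear {μ : Fin d} {x y : Site d} {τ : Fin d} (h : BondNear μ x y τ) : linfDist x y ≤ 1 := by
  obtain ⟨z, κ, ν, ⟨-, hx⟩, hy⟩ := h
  rw [linfDist_le_iff]
  intro i
  have h1 := near_of_isSide hx i
  have h2 := near_of_isSide hy i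
  omega

/-- `Δ′(U₀)0 = 0`. [cite: Balaban1985BackgroundPropagators, (3.10) p.392 (a linear operator)] -/
theorem DpZd_zero (η : ℝ) (U₀ : Site d → Fin d → 𝔸ˣ) : DpZd η U₀ (0 : Site d → Fin d → 𝔸) = 0 := by
  have h := DpZd_smul η U₀ (0 : ℂ) (0 : Site d → Fin d → 𝔸)
  rwa [zero_smul, zero_smul] at h

/-- **RANGE `1`**: `(Δ′(U₀) δ_{(z,κ)}w)(x, μ) = 0` unless `|x − z|_∞ ≤ 1` (print: «the supremum … is taken over bonds belonging to one of the plaquettes containing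
the bond b»). [cite: Balaban1985BackgroundPropagators, (3.69) p.404, (3.10) p.392] -/
theorem DpZd_bump_eq_zero_of_not_near (η : ℝ) (U₀ : Site d → Fin d → 𝔸ˣ) (z : Site d) (κ : Fin d) (w : 𝔸) (x : Site d) (μ : Fin d)
    (h : ¬ linfDist x z ≤ 1) : DpZd η U₀ (bump z κ w) x μ = 0 := by
  have h0 : DpZd η U₀ (bump z κ w) x μ = DpZd η U₀ (0 : Site d → Fin d → 𝔸) x μ := by
    refine DpZd_congr_local η U₀ fun y τ hn => ?_
    have hyz : y ≠ z := fun hyz => h (hyz ▸ linfDist_le_one_of_bondNear hn)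
    exact bump_eq_zero_of w fun hh => hyz hh.1
  rw [h0, DpZd_zero]
  rfl

variable [Nontrivial 𝔸]

/-- **SIZE `28(d−1)·η⁻²`** at a unitary background: `‖(Δ′(U₀) δ_{(z,κ)}w)(x, μ)‖ ≤ 28(d−1)·η⁻²·‖w‖` — print's (3.69) (`norm_DpZd_le_local`, O(1) = 14(d−1)) with
the trivial plaquette bound `|U₀(∂p) − 1| ≤ 2`. [cite: Balaban1985BackgroundPropagators, (3.69) p.404, (3.10) p.392, (3.28) p.395] -/
theorem norm_DpZd_bump_le (η : ℝ) {U₀ : Site d → Fin d → 𝔸ˣ} (hU : ∀ (x : Site d) (κ : Fin d), U₀ x κ ∈ unitaryUnits 𝔸)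
    (z : Site d) (κ : Fin d) (w : 𝔸) (x : Site d) (μ : Fin d) :
    ‖DpZd η U₀ (bump z κ w) x μ‖ ≤ 28 * ((d - 1 : ℕ) : ℝ) * (η⁻¹) ^ 2 * ‖w‖ := by
  have hU1 : ∀ (y : Site d) (ν : Fin d), U₀ y ν ∈ U1 𝔸 := fun y ν => unitaryUnits_le_U1 (hU y ν)
  have hplaq : ∀ (y : Site d) (κ' ν : Fin d), PlaqNear μ x y κ' ν → ‖plaqF U₀ κ' ν y - 1‖ ≤ 2 * ((((1 : ℝ) ^ (0 : ℕ))⁻¹) ^ 2) := by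
    intro y κ' ν _
    have h1 : ‖plaqF U₀ κ' ν y‖ ≤ 1 := (B7Prop1Explicit.mem_U1.mp (B7Prop1Explicit.hol_mem hU1 y (plaqWord κ' ν))).1
    calc ‖plaqF U₀ κ' ν y - 1‖ ≤ ‖plaqF U₀ κ' ν y‖ + ‖(1 : 𝔸)‖ := norm_sub_le _ _
      _ ≤ 1 + 1 := add_le_add h1 (by rw [norm_one])
      _ = 2 * ((((1 : ℝ) ^ (0 : ℕ))⁻¹) ^ 2) := by norm_num
  have h := norm_DpZd_le_local (η := η) (a := ‖w‖) (C := 2) (L := (1 : ℝ)) (j := 0) hU (bump z κ w) x μ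
    (fun y τ _ => norm_bump_apply_le z κ w y τ) hplaq
  refine h.trans (le_of_eq ?_)
  simp only [pow_zero, one_mul, inv_pow]
  ring

/-- size and range together: `‖(Δ′(U₀) δ_{(z,κ)}w)(x, μ)‖ ≤ 28(d−1)η⁻²·𝟙[|x − z|_∞ ≤ 1]·‖w‖`. [cite: Balaban1985BackgroundPropagators, (3.69) p.404] -/
theorem norm_DpZd_bump_le_indicator (η : ℝ) {U₀ : Site d → Fin d → 𝔸ˣ} (hU : ∀ (x : Site d) (κ : Fin d), U₀ x κ ∈ unitaryUnits 𝔸)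
    (z : Site d) (κ : Fin d) (w : 𝔸) (x : Site d) (μ : Fin d) :
    ‖DpZd η U₀ (bump z κ w) x μ‖ ≤ 28 * ((d - 1 : ℕ) : ℝ) * (η⁻¹) ^ 2 * (if linfDist x z ≤ 1 then (1 : ℝ) else 0) * ‖w‖ := by
  split_ifs with h
  · rw [mul_one]; exact norm_DpZd_bump_le η hU z κ w x μ
  · rw [DpZd_bump_eq_zero_of_not_near η U₀ z κ w x μ h, norm_zero, mul_zero, zero_mul]

/-- ★★ **THE `hDp` HYPOTHESIS OF THE STATION-5 ASSEMBLY** for the genuine `Δ′`: at a unitary background, for all bonds `b, b′` and `w`,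
`|(Δ′(U₀) δ_{b′}w)(b)|_τ ≤ (C_u·28(d−1)η⁻²·C_l)·𝟙[|b−b′|_∞ ≤ 1]·|w|_τ`. [cite: Balaban1985BackgroundPropagators, (3.26) p.395, (3.10) p.392, (3.69) p.404] -/
theorem fnorm_DpZd_bump_le (τ : 𝔸 →ₗ[ℂ] ℂ) {Cu Cl : ℝ} (hCu : ∀ a : 𝔸, fnorm τ a ≤ Cu * ‖a‖) (hCl : ∀ a : 𝔸, ‖a‖ ≤ Cl * fnorm τ a)
    (hCu0 : 0 ≤ Cu) (η : ℝ) {U₀ : Site d → Fin d → 𝔸ˣ} (hU : ∀ (x : Site d) (κ : Fin d), U₀ x κ ∈ unitaryUnits 𝔸)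
    (b b' : Site d × Fin d) (w : 𝔸) :
    fnorm τ (DpZd η U₀ (bump b'.1 b'.2 w) b.1 b.2) ≤
      (Cu * (28 * ((d - 1 : ℕ) : ℝ) * (η⁻¹) ^ 2) * Cl) * (if linfDist b.1 b'.1 ≤ 1 then (1 : ℝ) else 0) * fnorm τ w :=
  fnorm_le_indicator_of_norm_le τ hCu hCl hCu0 (by positivity) (norm_DpZd_bump_le_indicator η hU b'.1 b'.2 w b.1 b.2)

end Curvature

/-! ## §3  The letter `Q*aQ` (`QQZdP`, EDITION P) on a bump: range `2Lᵐ`, size `B_Q` -/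

section Averaging

variable (τ : 𝔸 →ₗ[ℂ] ℂ) [FiniteDimensional ℝ 𝔸] [Nontrivial 𝔸] (L : ℕ)

omit [CStarAlgebra 𝔸] [FiniteDimensional ℝ 𝔸] [Nontrivial 𝔸] in
/-- **TWO SITES OF ONE AVERAGING BOX ARE `2Lʲ`-CLOSE**: `y, y′ ∈ Bʲ(c₋) ∪ Bʲ(c₊) = [Lʲz, Lʲz + (Lʲ−1)𝟙 + Lʲe_κ] ⟹ |y − y′|_∞ ≤ 2Lʲ`.
[cite: Balaban1985Averaging, p.24 (after (43)), (141) p.39] -/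
theorem linfDist_le_of_inBox_inBox (j : ℕ) (z : Site d) (κ : Fin d) {y y' : Site d}
    (hy : InBox (loK L j z) (bondHiK L j z κ) y) (hy' : InBox (loK L j z) (bondHiK L j z κ) y') :
    linfDist y y' ≤ 2 * L ^ j := by
  rw [linfDist_le_iff]
  intro i
  have h1 := hy i
  have h2 := hy' i
  have hP : ((L ^ j : ℕ) : ℤ) = (L : ℤ) ^ j := by push_cast; rfl
  have hP0 : (0 : ℤ) ≤ (L : ℤ) ^ j := by positivity
  simp only [loK, bondHiK] at h1 h2
  split_ifs at h1 h2 <;> omega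

omit [FiniteDimensional ℝ 𝔸] [Nontrivial 𝔸] in
/-- `iη·δ_{b′}w = δ_{b′}(iη·w)`. [cite: Balaban1985RegularSpaces, (1.41) p.83 (the exponent variable `iηA`; bookkeeping)] -/
private theorem iEta_bump (η : ℝ) (y' : Site d) (μ' : Fin d) (w : 𝔸) :
    iEta η (bump y' μ' w) = bump y' μ' (((Complex.I : ℂ) * η) • w) := by
  funext x κ
  simp only [iEta, bump]
  split_ifs <;> simp

omit [FiniteDimensional ℝ 𝔸] [Nontrivial 𝔸] in
/-- `‖iη·w‖ = η‖w‖` (`η ≥ 0`). [cite: Balaban1985RegularSpaces, (1.41) p.83 (bookkeeping)] -/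
private theorem norm_I_eta_smul' {η : ℝ} (hη : 0 ≤ η) (w : 𝔸) : ‖((Complex.I : ℂ) * η) • w‖ = η * ‖w‖ := by
  rw [norm_smul, norm_mul, Complex.norm_I, one_mul, Complex.norm_real, Real.norm_eq_abs, abs_of_nonneg hη]

omit [Nontrivial 𝔸] in
/-- `β_τ ≥ 0` (private copy). [folklore] -/
private theorem betaTau_nonneg : 0 ≤ betaTau τ := by
  unfold betaTau
  split_ifs
  · exact Finset.sum_nonneg fun i _ => mul_nonneg (norm_nonneg _) (norm_nonneg _)
  · exact le_rfl

omit [FiniteDimensional ℝ 𝔸] [Nontrivial 𝔸] in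
/-- **LOCALITY OF THE COLUMN**: the linearised average `LʲηQ_j(U₀)` of a bump outside the box of the bond `c = ⟨z, z+e_κ⟩` vanishes at `c`.
[cite: Balaban1985Averaging, p.24 (after (43)), p.38 (before (133))] -/
theorem linCovIter_bump_eq_zero_of_not_inBox (hL : 1 ≤ L) (U₀ : Site d → Fin d → 𝔸ˣ) (j : ℕ) (z : Site d) (κ : Fin d) {y' : Site d} (μ' : Fin d)
    (X : 𝔸) (hy' : ¬ InBox (loK L j z) (bondHiK L j z κ) y') : linCovIter L U₀ (bump y' μ' X) j z κ = 0 := by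
  have h := linCovIter_congr L hL j (U₀ := U₀) (U₀' := U₀) (B := bump y' μ' X) (B' := (0 : Site d → Fin d → 𝔸)) z κ
    (fun _ _ _ _ => rfl) (fun x ν hx _ => by
      show bump y' μ' X x ν = 0
      refine bump_eq_zero_of X fun hh => hy' ?_
      rw [← hh.1]; exact hx)
  rw [h, linCovIter_zero_fun]
  rfl

omit [FiniteDimensional ℝ 𝔸] in
/-- **THE LEVEL-`j` INPUT OF `Q*_j` ON A BUMP, AT A WINDOW BOND**: for a unitary `U₀` in the class (1.7) (window `α_Q`, domains read one level up), a level `j ≤ m`, the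
level-`≥ 1` box clause «box ⊂ Ω_{j−1}» for the class bonds, a window bond `c` of the site `y` (its box contains `y`) and the bump `δ_{(y′,μ′)}w`:
`‖(𝟙_{Λ_j}·(−i)·LʲηQ_j(U₀)(iη·δ_{(y′,μ′)}w))(c)‖ ≤ 𝟙[|y − y′|_∞ ≤ 2Lᵐ]·(1+θ(α_Q))LʲL^{−jd}·η‖w‖` — the column bound (147) when the bump sits in the box of `c`
(then `y′` is `2Lʲ ≤ 2Lᵐ`-close to `y`), zero otherwise (locality). [cite: Balaban1985Averaging, (147) p.40, p.24; Balaban1985BackgroundPropagators, (3.16) p.393; Balaban1985RegularSpaces, (1.7) p.77, (1.31) p.82] -/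
theorem norm_clsField_bump_le (hL : 2 ≤ L) (ΛbP : ℕ → ℕ → Set (Site d × Fin d)) (i : ZdIdx d L) (m : ℕ)
    (hbox : ∀ j, 1 ≤ j → j ≤ m → ∀ c ∈ ΛbP m j, ∀ x, InBox (loK L j c.1) (bondHiK L j c.1 c.2) x → x ∈ i.Ω (j - 1))
    {U₀ : Site d → Fin d → 𝔸ˣ} (hU₀ : ∀ (x : Site d) (κ : Fin d), U₀ x κ ∈ unitaryUnits 𝔸)
    (hreg' : Reg17 L m (fun j => i.Ω (j - 1)) (alphaQ d L) U₀) {j : ℕ} (hj : j ≤ m)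
    (z : Site d) (κ : Fin d) {y : Site d} (hy : InBox (loK L j z) (bondHiK L j z κ) y) (y' : Site d) (μ' : Fin d) (w : 𝔸) :
    ‖clsField L ΛbP i.η m j U₀ (bump y' μ' w) z κ‖ ≤
      (if linfDist y y' ≤ 2 * L ^ m then (1 : ℝ) else 0) *
        ((1 + thetaGen d L (alphaQ d L)) * ((L : ℝ) ^ j * (((L : ℝ) ^ j) ^ d)⁻¹) * (i.η * ‖w‖)) := by
  classical
  have hL1 : 1 ≤ L := le_trans (by norm_num) hL
  have hαpos : 0 < alphaQ d L := alphaQ_pos d hL1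
  have hθ : 0 ≤ 1 + thetaGen d L (alphaQ d L) := by unfold thetaGen; positivity
  have hK0 : 0 ≤ (1 + thetaGen d L (alphaQ d L)) * ((L : ℝ) ^ j * (((L : ℝ) ^ j) ^ d)⁻¹) * (i.η * ‖w‖) := by
    have := i.hη.le; positivity
  simp only [clsField]
  split_ifs with hc hnear
  · -- class bond, near: the column bound (147)
    rw [one_mul, norm_smul, norm_neg, Complex.norm_I, one_mul, iEta_bump]
    have hcol := norm_linCovIter_bump_le_of_reg17₀ hL hαpos le_rfl hU₀ hreg' hj z κ
      (fun hj1 x hx => hbox j hj1 hj (z, κ) hc x hx) y' μ' (((Complex.I : ℂ) * i.η) • w)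
    rwa [norm_I_eta_smul' i.hη.le] at hcol
  · -- class bond, far: the bump is outside the box (else `y′` would be `2Lʲ ≤ 2Lᵐ`-close to `y`)
    have hfar : ¬ InBox (loK L j z) (bondHiK L j z κ) y' := fun hy'in =>
      hnear ((linfDist_le_of_inBox_inBox L j z κ hy hy'in).trans (Nat.mul_le_mul_left 2 (Nat.pow_le_pow_right hL1 hj)))
    have h0 := linCovIter_bump_eq_zero_of_not_inBox L hL1 U₀ j z κ μ' (((Complex.I : ℂ) * i.η) • w) hfar
    simp only [zero_mul, norm_smul, iEta_bump, h0, norm_zero, mul_zero, le_refl]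
  · rw [norm_zero, one_mul]; exact hK0
  · simp

/-- ★★ **THE AVERAGING LETTER ON A BUMP — RANGE `2Lᵐ`, SIZE `B_Q`, AT EVERY UNITARY BACKGROUND**: for `L ≥ 2`, a member `(i, m)`, a class `ΛbP` whose level-`j`
bonds (`1 ≤ j ≤ m`) have their box in `Ω_{j−1}`, a unitary `U₀` and `|Re τ(x*y)| ≤ C_τ‖x‖‖y‖`:
`‖(Q*aQ(U₀) δ_{(y′,μ′)}w)(y, μ)‖ ≤ B_Q·𝟙[|y − y′|_∞ ≤ 2Lᵐ]·‖w‖`, `B_Q = C_τβ_τ·2d·η·Σ_{j≤m} w_j·((1+θ(α_Q))LʲL^{−jd})²` — on the class (1.7) the letter is the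
genuine sum and every window bond's input obeys `norm_clsField_bump_le`, the transpose costs `C_τβ_τ` times the column constant (`norm_linCovIterT_le`); off the
class the letter is `0`. [cite: Balaban1985BackgroundPropagators, (3.16) p.393, (3.26) p.395; Balaban1985Averaging, (147) p.40, p.24; Balaban1985RegularSpaces, (1.7) p.77, (1.31) p.82, (1.56)∕(1.58) p.86] -/
theorem norm_QQZdP_bump_le (hL : 2 ≤ L) {Cτ : ℝ} (hCτ : ∀ x y : 𝔸, |(τ (star x * y)).re| ≤ Cτ * ‖x‖ * ‖y‖)
    (ΛbP : ℕ → ℕ → Set (Site d × Fin d)) (i : ZdIdx d L) (m : ℕ)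
    (hbox : ∀ j, 1 ≤ j → j ≤ m → ∀ c ∈ ΛbP m j, ∀ x, InBox (loK L j c.1) (bondHiK L j c.1 c.2) x → x ∈ i.Ω (j - 1))
    {U₀ : Site d → Fin d → 𝔸ˣ} (hU₀ : ∀ (x : Site d) (κ : Fin d), U₀ x κ ∈ unitaryUnits 𝔸)
    (y' : Site d) (μ' : Fin d) (w : 𝔸) (y : Site d) (μ : Fin d) :
    ‖QQZdP τ L ΛbP i m U₀ (bump y' μ' w) y μ‖ ≤
      (Cτ * betaTau τ * (2 * d) * i.η *
          ∑ j ∈ Finset.range (m + 1), wQ (d := d) L i.η j * ((1 + thetaGen d L (alphaQ d L)) * ((L : ℝ) ^ j * (((L : ℝ) ^ j) ^ d)⁻¹)) ^ 2) *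
        (if linfDist y y' ≤ 2 * L ^ m then (1 : ℝ) else 0) * ‖w‖ := by
  classical
  have hL1 : 1 ≤ L := le_trans (by norm_num) hL
  have hL0 : (0 : ℝ) < L := by exact_mod_cast (lt_of_lt_of_le (by norm_num) hL)
  have hαpos : 0 < alphaQ d L := alphaQ_pos d hL1
  have hθ : 0 ≤ 1 + thetaGen d L (alphaQ d L) := by unfold thetaGen; positivity
  have hCτ0 : 0 ≤ Cτ := by
    have h := hCτ 1 1
    simp only [norm_one, mul_one] at h
    exact (abs_nonneg _).trans h
  have hβ := betaTau_nonneg τ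
  have hη := i.hη.le
  have hw : 0 ≤ wQ (d := d) L i.η 0 := by unfold wQ; positivity
  have hind : 0 ≤ (if linfDist y y' ≤ 2 * L ^ m then (1 : ℝ) else 0) := by split_ifs <;> norm_num
  -- abbreviate the column constant
  obtain ⟨K, hK⟩ : ∃ K : ℕ → ℝ, K = fun j => (1 + thetaGen d L (alphaQ d L)) * ((L : ℝ) ^ j * (((L : ℝ) ^ j) ^ d)⁻¹) := ⟨_, rfl⟩
  have hK0 : ∀ j, 0 ≤ K j := fun j => by rw [hK]; positivity
  have hwQ : ∀ j, 0 ≤ wQ (d := d) L i.η j := fun j => by unfold wQ; positivity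
  have hKj : ∀ j, (1 + thetaGen d L (alphaQ d L)) * ((L : ℝ) ^ j * (((L : ℝ) ^ j) ^ d)⁻¹) = K j := fun j => by rw [hK]
  simp only [hKj]
  by_cases hreg : Reg17 L m i.Ω (alphaQ d L / (L : ℝ) ^ 2) U₀
  · have hreg' : Reg17 L m (fun j => i.Ω (j - 1)) (alphaQ d L) U₀ := by
      have h := reg17_shift hL1 hreg
      rwa [div_mul_cancel₀ _ (by positivity)] at h
    rw [QQZdP_of_reg17 τ L hreg]
    -- per level: `‖w_j • (Q_jᵀ B_j)(y,μ)‖ ≤ w_j · C_τβ_τK_j · (2d · 𝟙 · K_j · η‖w‖)`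
    have hterm : ∀ j ∈ Finset.range (m + 1),
        ‖(wQ (d := d) L i.η j) • linCovIterT τ L U₀ j (clsField L ΛbP i.η m j U₀ (bump y' μ' w)) y μ‖ ≤
          wQ (d := d) L i.η j * (Cτ * betaTau τ * K j *
            (2 * d * ((if linfDist y y' ≤ 2 * L ^ m then (1 : ℝ) else 0) * (K j * (i.η * ‖w‖))))) := by
      intro j hjm
      have hj : j ≤ m := by rw [Finset.mem_range] at hjm; omega
      rw [norm_smul, Real.norm_eq_abs, abs_of_nonneg (hwQ j)]
      refine mul_le_mul_of_nonneg_left ?_ (hwQ j)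
      -- the transpose bound, column by column (columns needed only where the input is non-zero, i.e. at class bonds)
      have hT := norm_linCovIterT_le τ hCτ L U₀ j (clsField L ΛbP i.η m j U₀ (bump y' μ' w)) y μ (hK0 j)
        (fun κ t hB X => by
          have hc : (winBase L j y κ t, κ) ∈ ΛbP m j := by
            by_contra hc
            exact hB (by unfold clsField; rw [if_neg hc])
          rw [← hKj]
          exact norm_linCovIter_bump_le_of_reg17₀ hL hαpos le_rfl hU₀ hreg' hj _ κ
            (fun hj1 x hx => hbox j hj1 hj _ hc x hx) y μ X)
      refine hT.trans (mul_le_mul_of_nonneg_left ?_ (by have := hK0 j; positivity))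
      -- the `2d` window bonds, each bounded by `norm_clsField_bump_le`
      have hwin : ∀ (κ : Fin d) (t : Fin 2), ‖clsField L ΛbP i.η m j U₀ (bump y' μ' w) (winBase L j y κ t) κ‖ ≤
          (if linfDist y y' ≤ 2 * L ^ m then (1 : ℝ) else 0) * (K j * (i.η * ‖w‖)) := by
        intro κ t
        rw [← hKj]
        exact norm_clsField_bump_le L hL ΛbP i m hbox hU₀ hreg' hj _ κ (inBox_winBase hL1 j y κ t) y' μ' w
      calc ∑ κ : Fin d, ∑ t : Fin 2, ‖clsField L ΛbP i.η m j U₀ (bump y' μ' w) (winBase L j y κ t) κ‖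
          ≤ ∑ κ : Fin d, ∑ t : Fin 2, (if linfDist y y' ≤ 2 * L ^ m then (1 : ℝ) else 0) * (K j * (i.η * ‖w‖)) :=
            Finset.sum_le_sum fun κ _ => Finset.sum_le_sum fun t _ => hwin κ t
        _ = 2 * d * ((if linfDist y y' ≤ 2 * L ^ m then (1 : ℝ) else 0) * (K j * (i.η * ‖w‖))) := by
            simp only [Finset.sum_const, Finset.card_univ, Fintype.card_fin, nsmul_eq_mul, Nat.cast_ofNat]
            ring
    refine (norm_sum_le _ _).trans ((Finset.sum_le_sum hterm).trans (le_of_eq ?_))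
    rw [Finset.mul_sum, Finset.sum_mul, Finset.sum_mul]
    refine Finset.sum_congr rfl fun j _ => ?_
    ring
  · rw [QQZdP_of_not_reg17 τ L hreg, norm_zero]
    have hS : 0 ≤ ∑ j ∈ Finset.range (m + 1), wQ (d := d) L i.η j * K j ^ 2 := Finset.sum_nonneg fun j _ => by
      have := hwQ j; have := hK0 j; positivity
    positivity

/-- ★★ **THE `hQQ` HYPOTHESIS OF THE STATION-5 ASSEMBLY** for the genuine `Q*aQ` (EDITION P): under the hypotheses of `norm_QQZdP_bump_le` and the fibre comparison,
for all bonds `b, b′` and `w`: `|(Q*aQ(U₀) δ_{b′}w)(b)|_τ ≤ (C_u·B_Q·C_l)·𝟙[|b−b′|_∞ ≤ 2Lᵐ]·|w|_τ`.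
[cite: Balaban1985BackgroundPropagators, (3.26) p.395, (3.16) p.393; Balaban1985Averaging, (147) p.40] -/
theorem fnorm_QQZdP_bump_le (hL : 2 ≤ L) {Cτ : ℝ} (hCτ : ∀ x y : 𝔸, |(τ (star x * y)).re| ≤ Cτ * ‖x‖ * ‖y‖)
    {Cu Cl : ℝ} (hCu : ∀ a : 𝔸, fnorm τ a ≤ Cu * ‖a‖) (hCl : ∀ a : 𝔸, ‖a‖ ≤ Cl * fnorm τ a) (hCu0 : 0 ≤ Cu)
    (ΛbP : ℕ → ℕ → Set (Site d × Fin d)) (i : ZdIdx d L) (m : ℕ)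
    (hbox : ∀ j, 1 ≤ j → j ≤ m → ∀ c ∈ ΛbP m j, ∀ x, InBox (loK L j c.1) (bondHiK L j c.1 c.2) x → x ∈ i.Ω (j - 1))
    {U₀ : Site d → Fin d → 𝔸ˣ} (hU₀ : ∀ (x : Site d) (κ : Fin d), U₀ x κ ∈ unitaryUnits 𝔸) (b b' : Site d × Fin d) (w : 𝔸) :
    fnorm τ (QQZdP τ L ΛbP i m U₀ (bump b'.1 b'.2 w) b.1 b.2) ≤
      (Cu * (Cτ * betaTau τ * (2 * d) * i.η *
          ∑ j ∈ Finset.range (m + 1), wQ (d := d) L i.η j * ((1 + thetaGen d L (alphaQ d L)) * ((L : ℝ) ^ j * (((L : ℝ) ^ j) ^ d)⁻¹)) ^ 2) * Cl) *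
        (if linfDist b.1 b'.1 ≤ 2 * L ^ m then (1 : ℝ) else 0) * fnorm τ w := by
  have hL1 : 1 ≤ L := le_trans (by norm_num) hL
  have hCτ0 : 0 ≤ Cτ := by
    have h := hCτ 1 1
    simp only [norm_one, mul_one] at h
    exact (abs_nonneg _).trans h
  have hβ := betaTau_nonneg τ
  have hη := i.hη.le
  have hθ : 0 ≤ 1 + thetaGen d L (alphaQ d L) := by have := alphaQ_pos d hL1; unfold thetaGen; positivity
  have hS : 0 ≤ ∑ j ∈ Finset.range (m + 1),
      wQ (d := d) L i.η j * ((1 + thetaGen d L (alphaQ d L)) * ((L : ℝ) ^ j * (((L : ℝ) ^ j) ^ d)⁻¹)) ^ 2 :=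
    Finset.sum_nonneg fun j _ => by
      have : 0 ≤ wQ (d := d) L i.η j := by unfold wQ; positivity
      positivity
  exact fnorm_le_indicator_of_norm_le τ hCu hCl hCu0 (by positivity) (norm_QQZdP_bump_le τ L hL hCτ ΛbP i m hbox hU₀ b'.1 b'.2 w b.1 b.2)

end Averaging

/-! ## §4  At the junction's four-letter record `opsAllZd` -/

section Record

variable (τ : 𝔸 →ₗ[ℂ] ℂ) [FiniteDimensional ℝ 𝔸] [Nontrivial 𝔸] (L : ℕ)
  (ΛbP : ℕ → ℕ → Set (Site d × Fin d)) (ops₀ : ℝ → ZdIdx d L → ℕ → OpsZd d 𝔸) (M : ℝ) (i : ZdIdx d L) (m : ℕ)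

/-- ★★★ **`hDp` AT THE RECORD**: the `Dp` field of `opsAllZd τ L ΛbP ops₀ M i m` is the genuine `Δ′` (`rfl`), so on bumps
`|((opsAllZd …).Dp U₀ δ_{b′}w)(b)|_τ ≤ (C_u·28(d−1)η⁻²·C_l)·𝟙[|b−b′|_∞ ≤ 1]·|w|_τ` at every unitary `U₀`.
[cite: Balaban1985BackgroundPropagators, (3.26) p.395, (3.10) p.392, (3.69) p.404] -/
theorem fnorm_Dp_opsAllZd_bump_le {Cu Cl : ℝ} (hCu : ∀ a : 𝔸, fnorm τ a ≤ Cu * ‖a‖) (hCl : ∀ a : 𝔸, ‖a‖ ≤ Cl * fnorm τ a) (hCu0 : 0 ≤ Cu)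
    {U₀ : Site d → Fin d → 𝔸ˣ} (hU₀ : ∀ (x : Site d) (κ : Fin d), U₀ x κ ∈ unitaryUnits 𝔸) (b b' : Site d × Fin d) (w : 𝔸) :
    fnorm τ ((opsAllZd τ L ΛbP ops₀ M i m).Dp U₀ (bump b'.1 b'.2 w) b.1 b.2) ≤
      (Cu * (28 * ((d - 1 : ℕ) : ℝ) * (i.η⁻¹) ^ 2) * Cl) * (if linfDist b.1 b'.1 ≤ 1 then (1 : ℝ) else 0) * fnorm τ w := by
  rw [opsAllZd_Dp]
  exact fnorm_DpZd_bump_le τ hCu hCl hCu0 i.η hU₀ b b' w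

/-- ★★★ **`hQQ` AT THE RECORD**: the `QQ` field of `opsAllZd τ L ΛbP ops₀ M i m` is EDITION P's `Q*aQ` (`rfl`), so on bumps, under the level-`≥ 1` box clause of
the class, `|((opsAllZd …).QQ U₀ δ_{b′}w)(b)|_τ ≤ (C_u·B_Q·C_l)·𝟙[|b−b′|_∞ ≤ 2Lᵐ]·|w|_τ` at every unitary `U₀`.
[cite: Balaban1985BackgroundPropagators, (3.26) p.395, (3.16) p.393; Balaban1985Averaging, (147) p.40] -/
theorem fnorm_QQ_opsAllZd_bump_le (hL : 2 ≤ L) {Cτ : ℝ} (hCτ : ∀ x y : 𝔸, |(τ (star x * y)).re| ≤ Cτ * ‖x‖ * ‖y‖)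
    {Cu Cl : ℝ} (hCu : ∀ a : 𝔸, fnorm τ a ≤ Cu * ‖a‖) (hCl : ∀ a : 𝔸, ‖a‖ ≤ Cl * fnorm τ a) (hCu0 : 0 ≤ Cu)
    (hbox : ∀ j, 1 ≤ j → j ≤ m → ∀ c ∈ ΛbP m j, ∀ x, InBox (loK L j c.1) (bondHiK L j c.1 c.2) x → x ∈ i.Ω (j - 1))
    {U₀ : Site d → Fin d → 𝔸ˣ} (hU₀ : ∀ (x : Site d) (κ : Fin d), U₀ x κ ∈ unitaryUnits 𝔸) (b b' : Site d × Fin d) (w : 𝔸) :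
    fnorm τ ((opsAllZd τ L ΛbP ops₀ M i m).QQ U₀ (bump b'.1 b'.2 w) b.1 b.2) ≤
      (Cu * (Cτ * betaTau τ * (2 * d) * i.η *
          ∑ j ∈ Finset.range (m + 1), wQ (d := d) L i.η j * ((1 + thetaGen d L (alphaQ d L)) * ((L : ℝ) ^ j * (((L : ℝ) ^ j) ^ d)⁻¹)) ^ 2) * Cl) *
        (if linfDist b.1 b'.1 ≤ 2 * L ^ m then (1 : ℝ) else 0) * fnorm τ w := by
  rw [opsAllZd_QQ]
  exact fnorm_QQZdP_bump_le τ L hL hCτ hCu hCl hCu0 ΛbP i m hbox hU₀ b b' w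

/-- ★★★ **`hQQ` AT THE RECORD OVER PRINT'S CLASS OF THE CUBE MEMBER** (`ΛbP := cubeLamBP L a Mc ρ i.k`, `i.Ω = cubeFam false L a Mc ρ i.k`, `m ≤ i.k`,
`2 ≤ L ≤ ρ`): the box clause is dag-n05-c's `cubeLamBP_box_subset_pred` (`hbox0_cubeLamBP_of_eq`), nothing else displayed.
[cite: Balaban1985BackgroundPropagators, (3.26) p.395, (3.16) p.393; Balaban1985RegularSpaces, (1.31) p.82, (1.131) p.99] -/
theorem fnorm_QQ_opsAllZd_bump_le_cube (hL : 2 ≤ L) {Cτ : ℝ} (hCτ : ∀ x y : 𝔸, |(τ (star x * y)).re| ≤ Cτ * ‖x‖ * ‖y‖)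
    {Cu Cl : ℝ} (hCu : ∀ a : 𝔸, fnorm τ a ≤ Cu * ‖a‖) (hCl : ∀ a : 𝔸, ‖a‖ ≤ Cl * fnorm τ a) (hCu0 : 0 ≤ Cu)
    (a : Site d) (Mc : ℕ) {ρ : ℕ} (hρ : L ≤ ρ) (hΩ : i.Ω = cubeFam false L a Mc ρ i.k) (hm : m ≤ i.k)
    {U₀ : Site d → Fin d → 𝔸ˣ} (hU₀ : ∀ (x : Site d) (κ : Fin d), U₀ x κ ∈ unitaryUnits 𝔸) (b b' : Site d × Fin d) (w : 𝔸) :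
    fnorm τ ((opsAllZd τ L (cubeLamBP L a Mc ρ i.k) ops₀ M i m).QQ U₀ (bump b'.1 b'.2 w) b.1 b.2) ≤
      (Cu * (Cτ * betaTau τ * (2 * d) * i.η *
          ∑ j ∈ Finset.range (m + 1), wQ (d := d) L i.η j * ((1 + thetaGen d L (alphaQ d L)) * ((L : ℝ) ^ j * (((L : ℝ) ^ j) ^ d)⁻¹)) ^ 2) * Cl) *
        (if linfDist b.1 b'.1 ≤ 2 * L ^ m then (1 : ℝ) else 0) * fnorm τ w :=
  fnorm_QQ_opsAllZd_bump_le τ L (cubeLamBP L a Mc ρ i.k) ops₀ M i m hL hCτ hCu hCl hCu0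
    (hbox0_cubeLamBP_of_eq (le_trans (by norm_num) hL) i a Mc hρ hΩ hm) hU₀ b b' w

/-- ★★★ **THE THREE LOCAL-LETTER BOUNDS OF THE RECORD AT A CUBE MEMBER, PACKAGED AT ONE RANGE `r = 2Lᵐ`**: for a faithful `τ` with
`|Re τ(x*y)| ≤ C_τ‖x‖‖y‖` there are `B_J, B_{Δ′}, B_Q ≥ 0` such that at EVERY unitary `U₀`, for all `b, b′, w`: `hJ`, `hDp`, `hQQ` with the SAME range indicator
`𝟙[|b−b′|_∞ ≤ 2Lᵐ]` for the letters of `opsAllZd τ L (cubeLamBP …) ops₀ M i m` — exactly the three local inputs of dag-n06-w2's single-range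
`fnorm_deltaAOf_bump_le_of_letters` ∕ `exists_fnorm_gopZdH_bump_le_exp_of_letters` (`r := 2Lᵐ`, `B_loc ≥ B_J + B_{Δ′} + B_Q`) besides `DRD*`.
[cite: Balaban1985BackgroundPropagators, (3.26) p.395, (3.9)–(3.10) p.392, (3.16) p.393, (3.69) p.404] -/
theorem exists_letterBounds_opsAllZd_cube (hτp : ∀ a : 𝔸, a ≠ 0 → 0 < (τ (star a * a)).re) (hL : 2 ≤ L)
    {Cτ : ℝ} (hCτ : ∀ x y : 𝔸, |(τ (star x * y)).re| ≤ Cτ * ‖x‖ * ‖y‖)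
    (a : Site d) (Mc : ℕ) {ρ : ℕ} (hρ : L ≤ ρ) (hΩ : i.Ω = cubeFam false L a Mc ρ i.k) (hm : m ≤ i.k) :
    ∃ BJ BDp BQ : ℝ, 0 ≤ BJ ∧ 0 ≤ BDp ∧ 0 ≤ BQ ∧
      ∀ (U₀ : Site d → Fin d → 𝔸ˣ), (∀ (x : Site d) (κ : Fin d), U₀ x κ ∈ unitaryUnits 𝔸) →
        ∀ (b b' : Site d × Fin d) (w : 𝔸),
          fnorm τ (Jcur i.η U₀ (bump b'.1 b'.2 w) b.2 b.1) ≤ BJ * (if linfDist b.1 b'.1 ≤ 2 * L ^ m then (1 : ℝ) else 0) * fnorm τ w ∧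
          fnorm τ ((opsAllZd τ L (cubeLamBP L a Mc ρ i.k) ops₀ M i m).Dp U₀ (bump b'.1 b'.2 w) b.1 b.2) ≤
            BDp * (if linfDist b.1 b'.1 ≤ 2 * L ^ m then (1 : ℝ) else 0) * fnorm τ w ∧
          fnorm τ ((opsAllZd τ L (cubeLamBP L a Mc ρ i.k) ops₀ M i m).QQ U₀ (bump b'.1 b'.2 w) b.1 b.2) ≤
            BQ * (if linfDist b.1 b'.1 ≤ 2 * L ^ m then (1 : ℝ) else 0) * fnorm τ w := by
  have hL1 : 1 ≤ L := le_trans (by norm_num) hL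
  have hr : 1 ≤ 2 * L ^ m := le_trans (Nat.one_le_pow _ _ hL1) (Nat.le_mul_of_pos_left _ (by norm_num))
  obtain ⟨Cu, Cl, hCu0, hCl0, hCu, hCl⟩ := exists_fnorm_cmp τ hτp
  have hCτ0 : 0 ≤ Cτ := by
    have h := hCτ 1 1
    simp only [norm_one, mul_one] at h
    exact (abs_nonneg _).trans h
  have hβ := betaTau_nonneg τ
  have hη := i.hη.le
  have hθ : 0 ≤ 1 + thetaGen d L (alphaQ d L) := by have := alphaQ_pos d hL1; unfold thetaGen; positivity
  have hS : 0 ≤ ∑ j ∈ Finset.range (m + 1),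
      wQ (d := d) L i.η j * ((1 + thetaGen d L (alphaQ d L)) * ((L : ℝ) ^ j * (((L : ℝ) ^ j) ^ d)⁻¹)) ^ 2 :=
    Finset.sum_nonneg fun j _ => by
      have : 0 ≤ wQ (d := d) L i.η j := by unfold wQ; positivity
      positivity
  refine ⟨Cu * (16 * d * (i.η⁻¹) ^ 2) * Cl, Cu * (28 * ((d - 1 : ℕ) : ℝ) * (i.η⁻¹) ^ 2) * Cl,
    Cu * (Cτ * betaTau τ * (2 * d) * i.η *
      ∑ j ∈ Finset.range (m + 1), wQ (d := d) L i.η j * ((1 + thetaGen d L (alphaQ d L)) * ((L : ℝ) ^ j * (((L : ℝ) ^ j) ^ d)⁻¹)) ^ 2) * Cl,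
    by positivity, by positivity, by positivity, fun U₀ hU₀ b b' w => ⟨?_, ?_, ?_⟩⟩
  · exact fnorm_le_indicator_mono τ (by positivity) b.1 b'.1 hr (fnorm_Jcur_bump_le τ hCu hCl hCu0.le i.hη hU₀ b b' w)
  · exact fnorm_le_indicator_mono τ (by positivity) b.1 b'.1 hr (fnorm_Dp_opsAllZd_bump_le τ L _ ops₀ M i m hCu hCl hCu0.le hU₀ b b' w)
  · exact fnorm_QQ_opsAllZd_bump_le_cube τ L ops₀ M i m hL hCτ hCu hCl hCu0.le a Mc hρ hΩ hm hU₀ b b' w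

end Record

end Literature.MathematicalPhysics.QuantumFieldTheory.Balaban1983to89.B9Eq326LocalLettersBumpBoundsZd

end
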